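import Literature.AlgebraicGeometry.HodgeTheory.CyclicCoverPencilSlice
import Literature.AlgebraicGeometry.HodgeTheory.CyclicCoverPencilSolvedVector
import Literature.AlgebraicGeometry.Motives.UniversalHypersurfaceRegularLocusChartTarget
import Literature.Geometry.ComplexAnalytic.PhamBrieskornJoinBounded
import Literature.Geometry.ComplexAnalytic.PhamBrieskornFibreSymmetries
import HarnessLib

/-!
# The local Milnor fibre of a pencil member near the node: a homeomorphism onto a cut Pham–Brieskorn fibre,
# injective on `H₂`

Family `hodge`, layer `Literature/AlgebraicGeometry/HodgeTheory`; step A4a of the programme discharging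
`carlsonToledo1999_nodalMeridianLocalMonodromyBound` (crux K1 of
`Summits/HodgeConjecture/HodgeConjecture/Theses/CyclicUnitaryPowers.lean`). For a member `X_c = {Q ∈ S | c(Q) = c}`
(`pencilFibre p c`, `c ≠ 0` small) of the nodal pencil `x₃^p = f₁ + c·x₂^p` read in the regular locus `𝒴°(ℂ)`, and the part
`A = X_c ∩ {F < T'}` of it inside the Morse ball (`F` the saturated Morse radius of the holomorphic Morse chart `Θ`,
`Σ (Θ y)ᵢ^{aᵢ} = φ(y)`, `a = (2, 2, p)`), the map

  `e : A → F_a = {Σ zᵢ^{aᵢ} = 1}`,  `e(Q)ᵢ = Θ(y(Q))ᵢ / λᵢ`  (`λᵢ^{aᵢ} = c`)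

(Morse coordinates followed by the weighted rescaling of the local Milnor fibre `{Σ wᵢ^{aᵢ} = c}` to `{Σ zᵢ^{aᵢ} = 1}`) is a
HOMEOMORPHISM onto the cut fibre `F_a ∩ E`, `E = {Σ |λᵢ|² |zᵢ|² < T'}` (inverse: `z ↦ Φ⁻¹(b'₀, Θ⁻¹(λ z))`, a point of `𝒴°(ℂ)` because
the member `x₃^p = f₁ + c x₂^p` is nonsingular), and `E` is a coordinatewise-monotone neighbourhood of Milnor's join when
`Σ |λᵢ|² < T'`; so by `PhamBrieskornJoinBounded` (`F_a ∩ E ↪ F_a` is an isomorphism on homology) **`e` followed by the inclusion is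
injective on `H₂(·; ℚ)`** — the input `hinj` of `PhamBrieskornCyclicNodeLocalisationHomotopy`. Main result:
`exists_localFibreChart` (the map `e : C(A, F_a)` with its formula and the injectivity). Milnor §9 (the local fibre is the
Pham–Brieskorn fibre up to rescaling), AGZV II §2.1.

Everything is proved; one concrete definition (`pencilFibre`); no named facts.

## References

* [Milnor1968] J. Milnor, Singular Points of Complex Hypersurfaces, §9 Lemma 9.2, Lemma 9.4, Thm. 9.1.
* [ArnoldGuseinzadeVarchenko2012] V. I. Arnold, S. M. Gusein-Zade, A. N. Varchenko, Singularities of Differentiable Maps II (2012), Part I §2.1.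
* [CarlsonToledo1999] J. A. Carlson, D. Toledo, Duke Math. J. 97 (1999), §6 (kdoublept).
-/

noncomputable section

open CategoryTheory AlgebraicGeometry MvPolynomial TopologicalSpace Set Topology Filter Complex
open scoped Manifold ContDiff Real
open Literature.AlgebraicGeometry.Motives Literature.AlgebraicGeometry.Motives.UniversalHypersurface
open Literature.AlgebraicGeometry.HodgeTheory.UniversalHypersurface Literature.Geometry.ComplexAnalytic Literature.Geometry.Manifold
open Literature.AlgebraicTopology.SingularHomology

namespace Literature.AlgebraicGeometry.HodgeTheory

/-- **The member `X_c` of the nodal pencil read in the regular locus**: the points of the pencil slice with pencil coordinate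
`c`. [cite: CarlsonToledo1999, §6 (kdoublept)] -/
def pencilFibre (p : ℕ) (c : ℂ) : Set (ComplexPoints (regularTotal ℂ 2 p)) :=
  {Q | Q ∈ pencilSlice p ∧ pencilCoord p Q = c}

/-- Membership in `X_c`, unfolded. [cite: CarlsonToledo1999, §6 (kdoublept)] -/
theorem mem_pencilFibre_iff (p : ℕ) (c : ℂ) (Q : ComplexPoints (regularTotal ℂ 2 p)) :
    Q ∈ pencilFibre p c ↔ Q ∈ pencilSlice p ∧ pencilCoord p Q = c :=
  Iff.rfl

/-- **`X_c` is the set of points with coefficient vector `b₀ − c·e_{x₂^p}`** (`p ≥ 3`). [cite: CarlsonToledo1999, §6 (kdoublept)] -/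
theorem mem_pencilFibre_iff_regCoeff_eq {p : ℕ} (hp : 3 ≤ p) (c : ℂ) (Q : ComplexPoints (regularTotal ℂ 2 p)) :
    Q ∈ pencilFibre p c ↔ regCoeff ℂ 2 p Q =
      coeffsOf 2 p (cyclicCoverForm p (X 2 ^ (p - 2) * (X 0 * X 1) + X 0 ^ p + X 1 ^ p)) - Pi.single (regPowIndex 2 p 2) c := by
  constructor
  · rintro ⟨hS, hc⟩
    rw [regCoeff_eq_sub_single_pencilCoord p hp hS, hc]
  · intro h
    have hS : Q ∈ pencilSlice p := fun m => by
      rw [h, Pi.sub_apply, Pi.single_eq_of_ne m.2, sub_zero]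
    refine ⟨hS, ?_⟩
    have h1 := congrFun (regCoeff_eq_sub_single_pencilCoord p hp hS) (regPowIndex 2 p 2)
    rw [h, Pi.sub_apply, Pi.sub_apply, Pi.single_eq_same, Pi.single_eq_same] at h1
    exact (sub_right_inj.mp h1).symm ▸ rfl

section LocalFibre

variable {p : ℕ} (hp : 3 ≤ p)
  (Φ : OpenPartialHomeomorph (ComplexPoints (regularTotal ℂ 2 p)) (({m : DegIndex 2 p // m ≠ regPowIndex 2 p 2} ⊕ Fin (2 + 1)) → ℂ))
  (hΦ : ⇑Φ = regChartFun 2 p 2) (hΦs : Φ.source = regChartDom 2 p 2) (hΦt : Φ.target = regChartFun 2 p 2 '' regChartDom 2 p 2)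
  (Θ : OpenPartialHomeomorph (Fin (1 + 2) → ℂ) (Fin (1 + 2) → ℂ)) {r R''' R'' : ℝ}
  (hr : {z : Fin (1 + 2) → ℂ | ∑ i, ‖z i‖ ^ 2 ≤ r ^ 2} ⊆ Θ.target)
  (hΘφ : ∀ x ∈ Θ.source, ∑ i, (Θ x) i ^ PhamBrieskorn.cyclicNodeExponents p i = x 2 ^ p - (x 0 * x 1 + x 0 ^ p + x 1 ^ p))
  {ρW : ℝ}
  (hns : ∀ c : ℂ, c ≠ 0 → ‖c‖ < ρW → SmoothHypersurface.IsNonsingularForm ℂ (formOfCoeffs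
    (coeffsOf 2 p (cyclicCoverForm p (X 2 ^ (p - 2) * (X 0 * X 1) + X 0 ^ p + X 1 ^ p)) - Pi.single (regPowIndex 2 p 2) c)))
  (hR : R''' < R'') {T' : ℝ} (hT'R : T' ≤ R''') (hT'r : T' ≤ r ^ 2)
  {c : ℂ} (hc0 : c ≠ 0) (hcρ : ‖c‖ < ρW)
  (lam : Fin (1 + 2) → ℂ) (hlam : ∀ i, lam i ^ PhamBrieskorn.cyclicNodeExponents p i = c)
include hp hΦ hΦs hΦt hr hΘφ hns hR hT'R hT'r hc0 hcρ hlam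

omit hp hΦ hΦs hΦt hr hΘφ hns hR hT'R hT'r hc0 hcρ hlam in
/-- The rescaling constants are non-zero. [cite: Milnor1968, §9 Lemma 9.4] -/
theorem localFibre_lam_ne_zero (hp : 3 ≤ p) (hc0 : c ≠ 0) (hlam : ∀ i, lam i ^ PhamBrieskorn.cyclicNodeExponents p i = c)
    (i : Fin (1 + 2)) : lam i ≠ 0 := by
  intro h
  have := hlam i
  rw [h, zero_pow (PhamBrieskorn.cyclicNodeExponents_ne_zero p (by omega) i)] at this
  exact hc0 this.symm

omit hΦ hΦt hr hns hT'r hc0 hcρ hlam in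
/-- **Data of a point of `A = X_c ∩ {F < T'}`**: it lies in the chart domain, its affine coordinates `y` are in `Θ.source`,
`Σ|Θ y|² = F`, and `Σ (Θ y)ᵢ^{aᵢ} = c`. [cite: Milnor1968, §9 Lemma 9.4] [cite: ArnoldGuseinzadeVarchenko2012, Part I §2.1] -/
theorem localFibre_point {Q : ComplexPoints (regularTotal ℂ 2 p)} (hQ : Q ∈ pencilFibre p c) (hF : satRadius p Θ R''' R'' Q < T') :
    Q ∈ Φ.source ∧ (fun j => regChartFun 2 p 2 Q (Sum.inr j)) ∈ Θ.source ∧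
      ∑ i, ‖Θ (fun j => regChartFun 2 p 2 Q (Sum.inr j)) i‖ ^ 2 = satRadius p Θ R''' R'' Q ∧
      ∑ i, (Θ (fun j => regChartFun 2 p 2 Q (Sum.inr j))) i ^ PhamBrieskorn.cyclicNodeExponents p i = c := by
  obtain ⟨hQd, hy, hSig⟩ := mem_of_satRadius_lt p Θ R''' R'' hR (lt_of_lt_of_le hF hT'R)
  refine ⟨hΦs ▸ hQd, hy, hSig, ?_⟩
  rw [hΘφ _ hy, ← hQ.2, pencilCoord_eq_phi p hp hQd hQ.1]

omit hΦ hΦt hr hns hT'r hcρ in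
/-- **`e(Q) = (Θ(y(Q))ᵢ / λᵢ)ᵢ` lies in the cut fibre `F_a ∩ {Σ|λᵢ|²|zᵢ|² < T'}`.** [cite: Milnor1968, §9 Lemma 9.4 and Thm. 9.1] -/
theorem localFibre_mem {Q : ComplexPoints (regularTotal ℂ 2 p)} (hQ : Q ∈ pencilFibre p c) (hF : satRadius p Θ R''' R'' Q < T') :
    (fun i => Θ (fun j => regChartFun 2 p 2 Q (Sum.inr j)) i / lam i) ∈
      PhamBrieskorn.fibre (PhamBrieskorn.cyclicNodeExponents p) ∩ {z : Fin (1 + 2) → ℂ | ∑ i, ‖lam i‖ ^ 2 * ‖z i‖ ^ 2 < T'} := by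
  obtain ⟨-, -, hSig, hsum⟩ := localFibre_point hp Φ hΦs Θ hΘφ hR hT'R hQ hF
  have hl0 := localFibre_lam_ne_zero lam hp hc0 hlam
  constructor
  · rw [PhamBrieskorn.mem_fibre]
    have h : ∀ i, (Θ (fun j => regChartFun 2 p 2 Q (Sum.inr j)) i / lam i) ^ PhamBrieskorn.cyclicNodeExponents p i =
        (Θ (fun j => regChartFun 2 p 2 Q (Sum.inr j))) i ^ PhamBrieskorn.cyclicNodeExponents p i / c := fun i => by
      rw [div_pow, hlam i]
    simp_rw [h, ← Finset.sum_div, hsum, div_self hc0]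
  · show ∑ i, ‖lam i‖ ^ 2 * ‖Θ (fun j => regChartFun 2 p 2 Q (Sum.inr j)) i / lam i‖ ^ 2 < T'
    have h : ∀ i, ‖lam i‖ ^ 2 * ‖Θ (fun j => regChartFun 2 p 2 Q (Sum.inr j)) i / lam i‖ ^ 2 =
        ‖Θ (fun j => regChartFun 2 p 2 Q (Sum.inr j)) i‖ ^ 2 := fun i => by
      rw [norm_div, div_pow, ← mul_div_assoc, mul_div_cancel_left₀ _ (pow_ne_zero 2 (norm_ne_zero_iff.mpr (hl0 i)))]
    simp_rw [h, hSig]; exact hF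

/-! ### The inverse `z ↦ Φ⁻¹(b'₀, Θ⁻¹(λ z))` -/

omit hp hΦ hΦs hΦt hΘφ hns hR hT'R hc0 hcρ hlam in
/-- For `z` in the cut, `λ z` lies in the chart ball `{Σ|w|² < T'} ⊆ Θ.target`. [cite: Milnor1968, §9 Lemma 9.4] -/
theorem localFibre_smul_mem_target {z : Fin (1 + 2) → ℂ} (hz : z ∈ {z : Fin (1 + 2) → ℂ | ∑ i, ‖lam i‖ ^ 2 * ‖z i‖ ^ 2 < T'}) :
    ∑ i, ‖(lam * z) i‖ ^ 2 < T' ∧ lam * z ∈ Θ.target := by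
  have h : ∑ i, ‖(lam * z) i‖ ^ 2 = ∑ i, ‖lam i‖ ^ 2 * ‖z i‖ ^ 2 :=
    Finset.sum_congr rfl fun i _ => by rw [Pi.mul_apply, norm_mul, mul_pow]
  refine ⟨h ▸ hz, hr ?_⟩
  show ∑ i, ‖(lam * z) i‖ ^ 2 ≤ r ^ 2
  rw [h]; exact (le_of_lt hz).trans hT'r

omit hp hΦ hΦs hΦt hns hR hT'R hc0 hcρ in
/-- **The affine point `y' = Θ⁻¹(λ z)` of a point `z` of the cut fibre**: `y' ∈ Θ.source`, `Θ y' = λ z`, `φ(y') = c`,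
`Σ|Θ y'|² = Σ|λᵢ|²|zᵢ|²`. [cite: Milnor1968, §9 Lemma 9.4] -/
theorem localFibre_inv_affine {z : Fin (1 + 2) → ℂ}
    (hz : z ∈ PhamBrieskorn.fibre (PhamBrieskorn.cyclicNodeExponents p) ∩ {z : Fin (1 + 2) → ℂ | ∑ i, ‖lam i‖ ^ 2 * ‖z i‖ ^ 2 < T'}) :
    Θ.symm (lam * z) ∈ Θ.source ∧ Θ (Θ.symm (lam * z)) = lam * z ∧
      (Θ.symm (lam * z)) 2 ^ p - ((Θ.symm (lam * z)) 0 * (Θ.symm (lam * z)) 1 + (Θ.symm (lam * z)) 0 ^ p +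
        (Θ.symm (lam * z)) 1 ^ p) = c ∧
      ∑ i, ‖Θ (Θ.symm (lam * z)) i‖ ^ 2 = ∑ i, ‖lam i‖ ^ 2 * ‖z i‖ ^ 2 := by
  obtain ⟨-, ht⟩ := localFibre_smul_mem_target Θ hr hT'r lam hz.2
  have hy : Θ.symm (lam * z) ∈ Θ.source := Θ.map_target ht
  have hΘy : Θ (Θ.symm (lam * z)) = lam * z := Θ.right_inv ht
  refine ⟨hy, hΘy, ?_, ?_⟩
  · rw [← hΘφ _ hy, hΘy]
    have h : ∀ i, (lam * z) i ^ PhamBrieskorn.cyclicNodeExponents p i = c * z i ^ PhamBrieskorn.cyclicNodeExponents p i :=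
      fun i => by rw [Pi.mul_apply, mul_pow, hlam i]
    simp_rw [h, ← Finset.mul_sum, PhamBrieskorn.mem_fibre.mp hz.1, mul_one]
  · rw [hΘy]
    exact Finset.sum_congr rfl fun i _ => by rw [Pi.mul_apply, norm_mul, mul_pow]

omit hΦ hΦs hR hT'R in
/-- **The coordinate vector `(b'₀, Θ⁻¹(λ z))` lies in `Φ.target`**: the solved form there is `x₃^p − f₁ − c x₂^p`, nonsingular for
`0 < |c| < ρW`. [cite: Milnor1968, §9 Lemma 9.4] [cite: CarlsonToledo1999, §6 (kdoublept)] -/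
theorem localFibre_inv_mem_target {z : Fin (1 + 2) → ℂ}
    (hz : z ∈ PhamBrieskorn.fibre (PhamBrieskorn.cyclicNodeExponents p) ∩ {z : Fin (1 + 2) → ℂ | ∑ i, ‖lam i‖ ^ 2 * ‖z i‖ ^ 2 < T'}) :
    (Sum.elim (fun m : {m : DegIndex 2 p // m ≠ regPowIndex 2 p 2} =>
        coeffsOf 2 p (cyclicCoverForm p (X 2 ^ (p - 2) * (X 0 * X 1) + X 0 ^ p + X 1 ^ p)) m.1) (Θ.symm (lam * z)) :
      ({m : DegIndex 2 p // m ≠ regPowIndex 2 p 2} ⊕ Fin (2 + 1)) → ℂ) ∈ Φ.target := by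
  obtain ⟨-, -, hφ, -⟩ := localFibre_inv_affine Θ hr hΘφ hT'r lam hlam hz
  rw [hΦt]
  refine mem_image_regChartFun_of_nonsingular 2 p 2 (by omega) _ ?_
  rw [regChartCoeffVec_nodalPencil_eq p hp, hφ]
  exact hns c hc0 hcρ

omit hT'R in
/-- **The inverse point `Q(z) = Φ⁻¹(b'₀, Θ⁻¹(λ z))`**: it lies in `Φ.source` with chart coordinates `(b'₀, Θ⁻¹(λ z))`, belongs to
`X_c`, has `F(Q(z)) = Σ|λᵢ|²|zᵢ|² < T'`, and `e(Q(z)) = z`. [cite: Milnor1968, §9 Lemma 9.4] -/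
theorem localFibre_inv_spec (hT'R : T' ≤ R''') {z : Fin (1 + 2) → ℂ}
    (hz : z ∈ PhamBrieskorn.fibre (PhamBrieskorn.cyclicNodeExponents p) ∩ {z : Fin (1 + 2) → ℂ | ∑ i, ‖lam i‖ ^ 2 * ‖z i‖ ^ 2 < T'}) :
    Φ.symm (Sum.elim (fun m : {m : DegIndex 2 p // m ≠ regPowIndex 2 p 2} =>
        coeffsOf 2 p (cyclicCoverForm p (X 2 ^ (p - 2) * (X 0 * X 1) + X 0 ^ p + X 1 ^ p)) m.1) (Θ.symm (lam * z))) ∈ Φ.source ∧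
      regChartFun 2 p 2 (Φ.symm (Sum.elim (fun m : {m : DegIndex 2 p // m ≠ regPowIndex 2 p 2} =>
        coeffsOf 2 p (cyclicCoverForm p (X 2 ^ (p - 2) * (X 0 * X 1) + X 0 ^ p + X 1 ^ p)) m.1) (Θ.symm (lam * z)))) =
        Sum.elim (fun m : {m : DegIndex 2 p // m ≠ regPowIndex 2 p 2} =>
          coeffsOf 2 p (cyclicCoverForm p (X 2 ^ (p - 2) * (X 0 * X 1) + X 0 ^ p + X 1 ^ p)) m.1) (Θ.symm (lam * z)) ∧
      Φ.symm (Sum.elim (fun m : {m : DegIndex 2 p // m ≠ regPowIndex 2 p 2} =>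
        coeffsOf 2 p (cyclicCoverForm p (X 2 ^ (p - 2) * (X 0 * X 1) + X 0 ^ p + X 1 ^ p)) m.1) (Θ.symm (lam * z))) ∈ pencilFibre p c ∧
      satRadius p Θ R''' R'' (Φ.symm (Sum.elim (fun m : {m : DegIndex 2 p // m ≠ regPowIndex 2 p 2} =>
        coeffsOf 2 p (cyclicCoverForm p (X 2 ^ (p - 2) * (X 0 * X 1) + X 0 ^ p + X 1 ^ p)) m.1) (Θ.symm (lam * z)))) =
        ∑ i, ‖lam i‖ ^ 2 * ‖z i‖ ^ 2 ∧
      (fun i => Θ (fun j => regChartFun 2 p 2 (Φ.symm (Sum.elim (fun m : {m : DegIndex 2 p // m ≠ regPowIndex 2 p 2} =>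
        coeffsOf 2 p (cyclicCoverForm p (X 2 ^ (p - 2) * (X 0 * X 1) + X 0 ^ p + X 1 ^ p)) m.1) (Θ.symm (lam * z))))
          (Sum.inr j)) i / lam i) = z := by
  set v : ({m : DegIndex 2 p // m ≠ regPowIndex 2 p 2} ⊕ Fin (2 + 1)) → ℂ :=
    Sum.elim (fun m : {m : DegIndex 2 p // m ≠ regPowIndex 2 p 2} =>
      coeffsOf 2 p (cyclicCoverForm p (X 2 ^ (p - 2) * (X 0 * X 1) + X 0 ^ p + X 1 ^ p)) m.1) (Θ.symm (lam * z)) with hv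
  have hvt : v ∈ Φ.target := localFibre_inv_mem_target hp Φ hΦt Θ hr hΘφ hns hT'r hc0 hcρ lam hlam hz
  obtain ⟨hy, hΘy, hφ, hSig⟩ := localFibre_inv_affine Θ hr hΘφ hT'r lam hlam hz
  have hsrc : Φ.symm v ∈ Φ.source := Φ.map_target hvt
  have hchart : regChartFun 2 p 2 (Φ.symm v) = v := by rw [← hΦ]; exact Φ.right_inv hvt
  have hdom : Φ.symm v ∈ regChartDom 2 p 2 := hΦs ▸ hsrc
  have haff : (fun j => regChartFun 2 p 2 (Φ.symm v) (Sum.inr j)) = Θ.symm (lam * z) := by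
    funext j; rw [hchart]; rfl
  -- the coefficient vector of the inverse point
  have hcoeff : regCoeff ℂ 2 p (Φ.symm v) =
      coeffsOf 2 p (cyclicCoverForm p (X 2 ^ (p - 2) * (X 0 * X 1) + X 0 ^ p + X 1 ^ p)) - Pi.single (regPowIndex 2 p 2) c := by
    rw [regCoeff_eq_regChartCoeffVec 2 p 2 hdom, hchart, hv, regChartCoeffVec_nodalPencil_eq p hp, hφ]
  have hmem : Φ.symm v ∈ pencilFibre p c := (mem_pencilFibre_iff_regCoeff_eq hp c _).mpr hcoeff
  have hlt : ∑ i, ‖lam i‖ ^ 2 * ‖z i‖ ^ 2 < T' := hz.2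
  refine ⟨hsrc, hchart, hmem, ?_, ?_⟩
  · rw [satRadius_eq_of_le p Θ R''' R'' hR hdom (haff ▸ hy) (by rw [haff, hSig]; exact hlt.le.trans hT'R), haff, hSig]
  · funext i
    rw [haff, hΘy, Pi.mul_apply, mul_div_cancel_left₀ _ (localFibre_lam_ne_zero lam hp hc0 hlam i)]

omit hΦt hr hns hT'r hcρ in
/-- **Left inverse**: `Q(e(Q)) = Q` for `Q ∈ A`. [cite: Milnor1968, §9 Lemma 9.4] -/
theorem localFibre_inv_apply {Q : ComplexPoints (regularTotal ℂ 2 p)} (hQ : Q ∈ pencilFibre p c) (hF : satRadius p Θ R''' R'' Q < T') :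
    Φ.symm (Sum.elim (fun m : {m : DegIndex 2 p // m ≠ regPowIndex 2 p 2} =>
        coeffsOf 2 p (cyclicCoverForm p (X 2 ^ (p - 2) * (X 0 * X 1) + X 0 ^ p + X 1 ^ p)) m.1)
        (Θ.symm (lam * fun i => Θ (fun j => regChartFun 2 p 2 Q (Sum.inr j)) i / lam i))) = Q := by
  obtain ⟨hQs, hy, -, -⟩ := localFibre_point hp Φ hΦs Θ hΘφ hR hT'R hQ hF
  have hl0 := localFibre_lam_ne_zero lam hp hc0 hlam
  have hmul : (lam * fun i => Θ (fun j => regChartFun 2 p 2 Q (Sum.inr j)) i / lam i) =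
      Θ (fun j => regChartFun 2 p 2 Q (Sum.inr j)) := by
    funext i; rw [Pi.mul_apply, mul_div_cancel₀ _ (hl0 i)]
  rw [hmul, Θ.left_inv hy]
  have hv : (Sum.elim (fun m : {m : DegIndex 2 p // m ≠ regPowIndex 2 p 2} =>
        coeffsOf 2 p (cyclicCoverForm p (X 2 ^ (p - 2) * (X 0 * X 1) + X 0 ^ p + X 1 ^ p)) m.1)
        (fun j => regChartFun 2 p 2 Q (Sum.inr j)) :
      ({m : DegIndex 2 p // m ≠ regPowIndex 2 p 2} ⊕ Fin (2 + 1)) → ℂ) = Φ Q := by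
    funext s
    rcases s with m | j
    · rw [Sum.elim_inl, hΦ]
      have h := congrFun (regCoeff_eq_regChartCoeffVec 2 p 2 (hΦs ▸ hQs)) m.1
      rw [hQ.1 m, regChartCoeffVec_of_ne 2 p 2 _ m.2] at h
      exact h
    · rw [Sum.elim_inr, hΦ]
  rw [hv, Φ.left_inv hQs]

/-! ### The local fibre chart -/

/-- **The local Milnor fibre chart.** For `0 < |c| < ρW`, `λᵢ^{aᵢ} = c` with `Σ|λᵢ|² < T'` (`T' ≤ min(R''', r²)`), there is a continuous
map `e : A → F_a` from `A = X_c ∩ {F < T'}` to the Pham–Brieskorn fibre `F_a = {Σ zᵢ^{aᵢ} = 1}`, `a = (2, 2, p)`, given by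
`e(Q)ᵢ = Θ(y(Q))ᵢ / λᵢ`, which is **injective on `H₂(·; ℚ)`** (a homeomorphism onto the cut fibre `F_a ∩ {Σ|λᵢ|²|zᵢ|² < T'}`, whose
inclusion in `F_a` is a homology isomorphism since the cut contains Milnor's join). [cite: Milnor1968, §9 Lemma 9.2, Lemma 9.4, Thm. 9.1]
[cite: ArnoldGuseinzadeVarchenko2012, Part I §2.1] -/
theorem exists_localFibreChart (hΘc : ContinuousOn Θ Θ.source) (hlamT : ∑ i, ‖lam i‖ ^ 2 < T') :
    ∃ e : C(↥{Q : ↥(pencilFibre p c) | satRadius p Θ R''' R'' Q.1 < T'}, ↥(PhamBrieskorn.fibre (PhamBrieskorn.cyclicNodeExponents p))),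
      Function.Injective (singularHomology.map ℚ ℚ e 2).hom ∧
      ∀ Q, (e Q : Fin (1 + 2) → ℂ) = fun i => Θ (fun j => regChartFun 2 p 2 Q.1.1 (Sum.inr j)) i / lam i := by
  have hp0 : p ≠ 0 := by omega
  set a := PhamBrieskorn.cyclicNodeExponents p with ha_def
  have ha : ∀ i, a i ≠ 0 := PhamBrieskorn.cyclicNodeExponents_ne_zero p hp0
  set E : Set (Fin (1 + 2) → ℂ) := {z | ∑ i, ‖lam i‖ ^ 2 * ‖z i‖ ^ 2 < T'} with hE_def
  set A : Set ↥(pencilFibre p c) := {Q | satRadius p Θ R''' R'' Q.1 < T'} with hA_def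
  -- the forward map onto the cut fibre
  let e₀ : ↥A → ↥(PhamBrieskorn.fibre a ∩ E) := fun Q =>
    ⟨fun i => Θ (fun j => regChartFun 2 p 2 Q.1.1 (Sum.inr j)) i / lam i,
      localFibre_mem hp Φ hΦs Θ hΘφ hR hT'R hc0 lam hlam Q.1.2 Q.2⟩
  have he₀c : Continuous e₀ := by
    refine Continuous.subtype_mk (continuous_pi fun i => Continuous.div_const ?_ _) _
    -- `Q ↦ Θ (y Q) i` on `A`: `y = (Φ ·) ∘ inr` is continuous on `Φ.source`, `Θ` on `Θ.source`
    have hval : Continuous fun Q : ↥A => (Q.1.1 : ComplexPoints (regularTotal ℂ 2 p)) :=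
      continuous_subtype_val.comp continuous_subtype_val
    have hy : Continuous fun Q : ↥A => fun j => regChartFun 2 p 2 Q.1.1 (Sum.inr j) := by
      have h1 : ContinuousOn (fun x : ComplexPoints (regularTotal ℂ 2 p) => fun j => Φ x (Sum.inr j)) Φ.source :=
        (continuous_pi fun j => continuous_apply (Sum.inr j)).comp_continuousOn Φ.continuousOn
      have h2 := h1.comp_continuous hval fun Q => (localFibre_point hp Φ hΦs Θ hΘφ hR hT'R Q.1.2 Q.2).1
      rw [hΦ] at h2; exact h2
    have hΘy := hΘc.comp_continuous hy fun Q => (localFibre_point hp Φ hΦs Θ hΘφ hR hT'R Q.1.2 Q.2).2.1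
    exact (continuous_apply i).comp hΘy
  -- the inverse
  let g₀ : ↥(PhamBrieskorn.fibre a ∩ E) → ↥A := fun z =>
    ⟨⟨Φ.symm (Sum.elim (fun m : {m : DegIndex 2 p // m ≠ regPowIndex 2 p 2} =>
        coeffsOf 2 p (cyclicCoverForm p (X 2 ^ (p - 2) * (X 0 * X 1) + X 0 ^ p + X 1 ^ p)) m.1) (Θ.symm (lam * z.1))),
        (localFibre_inv_spec hp Φ hΦ hΦs hΦt Θ hr hΘφ hns hR hT'r hc0 hcρ lam hlam hT'R z.2).2.2.1⟩,
      by
        show satRadius p Θ R''' R'' _ < T'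
        rw [(localFibre_inv_spec hp Φ hΦ hΦs hΦt Θ hr hΘφ hns hR hT'r hc0 hcρ lam hlam hT'R z.2).2.2.2.1]
        exact z.2.2⟩
  have hg₀c : Continuous g₀ := by
    refine Continuous.subtype_mk (Continuous.subtype_mk ?_ _) _
    have hz : Continuous fun z : ↥(PhamBrieskorn.fibre a ∩ E) => lam * z.1 := continuous_const.mul continuous_subtype_val
    have hΘs : Continuous fun z : ↥(PhamBrieskorn.fibre a ∩ E) => Θ.symm (lam * z.1) :=
      Θ.continuousOn_symm.comp_continuous hz fun z => (localFibre_smul_mem_target Θ hr hT'r lam z.2.2).2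
    have hv : Continuous fun z : ↥(PhamBrieskorn.fibre a ∩ E) =>
        (Sum.elim (fun m : {m : DegIndex 2 p // m ≠ regPowIndex 2 p 2} =>
          coeffsOf 2 p (cyclicCoverForm p (X 2 ^ (p - 2) * (X 0 * X 1) + X 0 ^ p + X 1 ^ p)) m.1) (Θ.symm (lam * z.1)) :
          ({m : DegIndex 2 p // m ≠ regPowIndex 2 p 2} ⊕ Fin (2 + 1)) → ℂ) := by
      refine continuous_pi fun s => ?_
      rcases s with m | j
      · exact continuous_const
      · exact (continuous_apply j).comp hΘs
    exact Φ.continuousOn_symm.comp_continuous hv fun z =>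
      localFibre_inv_mem_target hp Φ hΦt Θ hr hΘφ hns hT'r hc0 hcρ lam hlam z.2
  -- the homeomorphism `A ≃ₜ F_a ∩ E`
  let η : ↥A ≃ₜ ↥(PhamBrieskorn.fibre a ∩ E) :=
    { toFun := e₀
      invFun := g₀
      left_inv := fun Q => Subtype.ext (Subtype.ext
        (localFibre_inv_apply hp Φ hΦ hΦs Θ hΘφ hR hT'R hc0 lam hlam Q.1.2 Q.2))
      right_inv := fun z => Subtype.ext
        (localFibre_inv_spec hp Φ hΦ hΦs hΦt Θ hr hΘφ hns hR hT'r hc0 hcρ lam hlam hT'R z.2).2.2.2.2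
      continuous_toFun := he₀c
      continuous_invFun := hg₀c }
  let ι : C(↥(PhamBrieskorn.fibre a ∩ E), ↥(PhamBrieskorn.fibre a)) :=
    ⟨Set.inclusion (Set.inter_subset_left : PhamBrieskorn.fibre a ∩ E ⊆ PhamBrieskorn.fibre a), continuous_inclusion _⟩
  refine ⟨ι.comp (η : C(↥A, ↥(PhamBrieskorn.fibre a ∩ E))), ?_, fun Q => rfl⟩
  -- injectivity on `H₂`: `ι_*` is bijective (the cut contains the join), `η_*` is an isomorphism
  have hE : ∀ z ∈ E, ∀ w : Fin (1 + 2) → ℂ, (∀ i, ‖w i‖ ≤ ‖z i‖) → w ∈ E := by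
    intro z hz w hw
    show ∑ i, ‖lam i‖ ^ 2 * ‖w i‖ ^ 2 < T'
    refine lt_of_le_of_lt (Finset.sum_le_sum fun i _ => ?_) hz
    exact mul_le_mul_of_nonneg_left (pow_le_pow_left₀ (norm_nonneg _) (hw i) 2) (sq_nonneg _)
  have hJE : PhamBrieskorn.join a ⊆ E :=
    PhamBrieskorn.join_subset_of_sum_lt ha (lam := fun i => ‖lam i‖ ^ 2) (fun i => sq_nonneg _) hlamT
  have hι := PhamBrieskorn.bijective_map_inclusion_fibre_inter a ℚ ℚ ha hE hJE 2
  have hη : Function.Bijective (singularHomology.map ℚ ℚ (η : C(↥A, ↥(PhamBrieskorn.fibre a ∩ E))) 2).hom :=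
    (singularHomology.mapIso ℚ ℚ η 2).toLinearEquiv.bijective
  rw [singularHomology.map_comp]
  exact hι.1.comp hη.1

end LocalFibre

end Literature.AlgebraicGeometry.HodgeTheory

end
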